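import Summits.ResolutionOfSingularities.ResolutionOfSingularities.Theorems.FrobeniusClosingPatchingRelPerfectDepthOneTargetsDefs
import Summits.ResolutionOfSingularities.ResolutionOfSingularities.Theorems.FrobeniusClosingPatchingRelPerfectDepthOneRegularizeSupport

/-!
# Chain W5.2 — r-d1 target A2s `DepthOneTargets.RegularizeSupport` HOLDS, BY NAME

[OURS · L1 W5.2] Three-line closure of plan-1's typed target A2s (`ChainW52TargetsE.lean` 9d67ec503d849faa,
now the tree module `…FrobeniusClosingPatchingRelPerfectDepthOneTargetsDefs.lean`, p496180) by the content
proof `DepthOneRegularize.regularizeSupport_of_seqPred` (`…DepthOneRegularizeSupport.lean`, p496841), which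
is generic in the sequence predicate: instantiate `P := IsControlledSeq` with its two constructors. Given
`CossartJannsenSaito2020EmbeddedSequenceB` (CJS 2020 Thm. 1.4, sequence form, corrected per-step clause;
F-32bR), every non-zero locally principal ideal sheaf on a regular, excellent, integral Noetherian scheme of
dimension three is carried by a controlled sequence (`IsControlledSeq`) to a non-zero locally principal ideal
sheaf on a regular integral Noetherian scheme whose support lies in a finite union of closed sets `D` with
`𝓘(D)` an effective Cartier divisor and `V(𝓘(D))` regular. Crux `PatchingRelPerfect`, item
stmt-ResolutionOfSingularities-16161, `--as helper`. NOT a statement of the manuscript under review; the CJS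
fact enters only as a hypothesis.

## References
* V. Cossart, U. Jannsen, S. Saito, *Desingularization: Invariants and Strategy*, LNM 2270 (2020),
  Thm. 1.4, Cor. 1.5. [CossartJannsenSaito2020]
* J. Kollár, *Lectures on Resolution of Singularities* (2007), (3.111) Step 3. [Kollar2007]
-/

noncomputable section

open CategoryTheory AlgebraicGeometry
open Literature.AlgebraicGeometry.Resolution

set_option linter.dupNamespace false

namespace Summit.ResolutionOfSingularities.ResolutionOfSingularities.Theorems.DepthOneTargets

universe u

/-- **A2s `RegularizeSupport` HOLDS** (by name): plan-1's typed target, closed by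
`DepthOneRegularize.regularizeSupport_of_seqPred` (p496841) at `P := IsControlledSeq`.
[cite: CossartJannsenSaito2020, Thm. 1.4, Cor. 1.5] [cite: Kollar2007, (3.111) Step 3] -/
theorem regularizeSupport_holds : RegularizeSupport.{u} :=
  fun hCJS E _ _ hreg hexc hdim 𝔟 h𝔟 hlp =>
    DepthOneRegularize.regularizeSupport_of_seqPred @IsControlledSeq (fun _ 𝔟 => IsControlledSeq.nil 𝔟)
      @IsControlledSeq.cons hCJS E hreg hexc hdim 𝔟 h𝔟 hlp

end Summit.ResolutionOfSingularities.ResolutionOfSingularities.Theorems.DepthOneTargets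

end
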